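import Summits.BirchSwinnertonDyer.Rank1Residual.F1Sign2.TranspositionDoorAtTwo
import Literature.NumberTheory.EllipticCurves.ModularCurve
import Summits.BirchSwinnertonDyer.Rank1Residual.F1Sign2.WildPacketAtTwo
import HarnessLib.Audit.Tags
import HarnessLib

/-!
# Cell `bsd-f1-sign2` — analytic lens (planner `-an` g23; MEMO-an v1.64 §26): AN-40 «θ-UNIT TRANSPORT AT 2» — Heegner-index parities as one mod-2
# modular form of level 4N (carriers `KummerBitAt`, `KummerBitAtInfinity`, `kummerConvolutionCount`, `kummerConvolutionFinite`, `heegnerIndexOf`,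
# `heckeDefect`, `HasTwoAdicTwoTorsion`, `heegnerParityRHS`, `sturmBoundGamma0Wt2`; AN-40b `HeegnerIndexKummerConvolutionLawAtTwo`, AN-40b′
# `HeegnerIndexParityRealLawAtTwo`, AN-40n `OddKummerConvolutionForcesHeegnerPointNonTorsion`, AN-40a `HeegnerThetaTransportAtTwo`, AN-40s
# `HeegnerParityHeckeModuleLawAtTwo`, AN-40c `HeegnerParitySturmCertificateAtTwo`, AN-40e `HeegnerIndexParityLawAllFundamentalAtTwo`, AN-40z
# `HeegnerIndexEvenOnIdentityComponentAtTwo`, AN-40h as `SingleHeckeDefectFormExistsAtTwo`; -an's two glue lemmas + REF1 §202's kernel certificates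
# K202.1–5 live in the sibling `ThetaUnitTransportAtTwoKernel.lean`)

STATEMENTS ONLY (no theorem; `lint.statement-form`), typer -ty g18.  Source: `HOME/MEMO-an-data/g23/lean/Sketch_g23.lean` **6c9d350391305f0b** (324 l., ns `…F1Sign2.ANg23`,
9 Props + 2 lemmas + 9 carriers; -an's battery `g23/lean/bc/Probe_g23.txt` P1–P5 CLEAN) and REF1's `HOME/REF1-data/b202/Probe202.lean` **6b0de3571c442ec6** (= the sketch
VERBATIM under `…ANg23.REF1s202` + 9 sorry probes + 5 sorry-free kernel lemmas; farm rc 0 · exactly 9 sorries · axioms std).  REF-GATED until REF1 g19 §202 (INBOX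
2026-08-29T14:21:03Z, PORT GATE): carriers, AN-40n, AN-40c, AN-40z VERBATIM (bodies byte-identical to the sketch AND Probe202, builder-verified); AN-40a VERBATIM with its
docstring corrected per R202a(iii); `heegnerParityRHS` ONLY with R202a(ii); **AN-40b/b′/e/s ONLY IN REF1's REPAIRED FORMS C′ (R202a(i) MANDATORY: binder `ShaTwoTrivial W →`;
AN-40e also R202a(ii) through the carrier and the R202c side-condition binder `4 < |d_K|`)** — the sketched bodies are BSD₂-inconsistent at the 24 `Ш_an = 4`
prime-conductor rank-one curves resp. at 1051a1/1259a1/1987a1 (`D = −8`) and were never in the tree; AN-40h only per R202b (renamed to what it types); -an's names and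
docstrings kept otherwise, a rider on each row stating REF1's verdict and the repair — the g14 `SelfTwistAtTwo` / g18 AN-39 precedent (data laws filed in REF1's C′ form).
R202a(ii)'s new carrier `¬ LocTwoDivisibleAtTwo W` is rendered by the EXISTING tree carrier `LocallyPrimitiveAtTwo W` (`F1Sign2/WildPacketAtTwo.lean`, AN-32's bottom bit
β: some rational point is not `2`-divisible in `E(ℚ₂)`) — typer rule: cite an existing decl rather than re-declare.  TAGS (typer, per REF1's verdict classes): conjecture-grade
rows `@[conjecture] def` — AN-40b′/b/n/s/e/z and `SingleHeckeDefectFormExistsAtTwo`; AN-40a (∃-form THEOREM-CANDIDATE modulo GKZ + Kohnen + constant) and AN-40c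
(PRINT-ASSEMBLY: Sturm 1987 Thm. 1 at `p = 2 ∣ 16N` + `χ₋₄`-twist level `16N`) as plain `def … : Prop`.  R202e (bib): `James1999`, `Kohnen1982` ADDED to `references.bib` by
the typer; `GrossKohnenZagier1987`, `KrizLi2019`, `OnoSkinner1998`, `Sturm1987`, `GrossZagier1986` present.  R202f (AN-40c decorative hypotheses) NOT applied (verbatim).
GRADES (REF1-AUDIT §202, evidence `HOME/REF1-data/b202/` SHA16.txt: `scan202.txt` e63c0ee60a427676 = the 2517 prime-conductor rank-one optimal curves `N < 5·10⁵`,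
`witness202.txt` 90b302d0c663792d): KILLED AS TYPED b, b′, e (repaired here); SURVIVE n (conjecture, exposed at `Ш ≠ 0`), a (∃-form), s (flagged; needs C′), c
(print-assembly), z (theorem-candidate modulo BSD₂(E/K)), h (mis-typed; R202b).  BC5 (MEMO-an §26, `HOME/MEMO-an-data/g23/` ENGINE TH kit j331452 + j331293 +
j331385, `ana/census_A.md`, `census_CP4.md`; local bits j332040): AN-40e on every fundamental Heegner `|D| ≤ 12 000` of the 12 first-order curves 39 096/0;
`2^{e_E}|c̃(ℓ)| = n(ℓ)` vs Sage 110/110; Hecke structure §G Δ<0 49 936/0, Δ>0 34 951/0.  REF2-PLACEMENT v54 §7 (A40-R1/R2; 13:56:55Z): nearest print Kriz–Li 2019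
Thm. 1.12 / Rem. 1.14 (twist variable, odd p-adic side, ★), James 1999 / Ono–Skinner 1998 (θ-transport of central VALUES), GKZ Thm. C; the `4`-cycle term, the
level-`4N` modularity of the INDEX-parity sequence and the tangent-vector reading NOT in print; PREDICTION #9 (‡) = REF2's, co-signed REF1.  T-an asks open (R202d α–δ):
`c̃(8)` at 1051a1/1259a1/1987a1 (j331386); ENGINE TH/RM at 35083b1, 45979a1, 48731a1 (`λ_E = 2`?); the `τ₂` branch of `−8u`; AN-40n's host test.  PARTITION none.
Beyond-print theorem: no.  BSD is not proved; 23715 not closed.  bears_on: stmt-BirchSwinnertonDyer-23715.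

## -an's module docstring of `Sketch_g23.lean` (verbatim; its «λ_E = 1 at prime level» is the `Ш_an = 1` census — see AN-40a's rider for REF1's J2 caveat)

# Cell `bsd-f1-sign2`, lens `-an` g23 — AN-40 THE θ-UNIT TRANSPORT AT `2`: HEEGNER-INDEX PARITIES ARE THE KUMMER TANGENT
# VECTOR OF THE MOD-2 HECKE ALGEBRA (sketch; statements only; nothing here proves BSD; crux 23715 not closed)

`E` = optimal curve of PRIME conductor `N`, analytic rank `1`, `E[2]` big image (`E(ℚ)[2] = 0`, `Gal(ℚ(E[2])/ℚ) ≅ S₃`), `f` its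
newform, `g = ∑ c(n) qⁿ ∈ S⁺_{3/2}(4N)` its Kohnen–Shimura partner normalised PRIMITIVE INTEGRAL (coefficients coprime; defined
up to sign).  Gross–Kohnen–Zagier (Math. Ann. 278, Thm. C): for a Heegner discriminant `D < 0`, `(D, 2N) = 1`, the `f`-part
of the Heegner divisor is `c(|D|)·y_f`, so `|c(|D|)| = λ_E · I(y_D)` with `I` the HEEGNER INDEX `[E(K_D) : ℤ y_D + tors]`
(`0` if `y_D` is torsion) and one constant `λ_E` per curve; two-engine census (ENGINE TH = PARI `mfkohnenbasis` + common
`T(p²)`-eigenvector, vs ENGINE RM/Sage `heegner_index`, g22) gives `λ_E = 1` at prime level.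
θ-TRANSPORT: `θ(τ) = ∑ q^{m²} ≡ 1 (mod 2)` is a unit of `𝔽₂[[q]]` and `gθ ∈ S₂(Γ₀(4N)) ∩ ℤ[[q]]`, so THE PARITY SEQUENCE
`n ↦ c(n) mod 2` IS THE q-EXPANSION OF A WEIGHT-2 CUSP FORM `Ĝ` OF LEVEL `4N` OVER `𝔽₂` (James 1999 / Ono–Skinner 1998 use
this for CM / rank-0 central VALUES; here it transports rank-1 Heegner INDICES).  Algebra: on `𝔽₂[[q]]` the weight-2
operator `A_ℓ z(n) = z(ℓn) + [ℓ∣n] z(n/ℓ)` squares to the weight-3/2 operator `T_{ℓ²} mod 2`, hence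
`(T_ℓ − a_ℓ)² Ĝ ≡ 0 (mod 2)` for every `ℓ ∤ 2N` (AN-40a (iii), theorem-shaped).  STRUCTURE CONJECTURE (AN-40s): the Hecke
module `𝕋̄·Ĝ ⊂ S₂(4N; 𝔽₂)` is `A/Ann ψ`, `A = 𝔽₂[ν₁, ν₂]/(ν₁², ν₂²)`, `T_ℓ ↦ (1 + h(ℓ)ν₁)(a_ℓ + t(ℓ)ν₂)` with
`h(ℓ) = [ℓ ≡ 3 (4)]` (infinitesimal `χ₋₄`-twist) and `t(ℓ)` = the KUMMER LINE BIT of `E(ℚ)` at `ℓ`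
(`E(ℚ_ℓ)/2E(ℚ_ℓ) ≅ ℤ/2`, i.e. Frobenius a transposition on `E[2]`, AND `E(ℚ) ↠ E(ℚ_ℓ)/2`; `t(∞) = [Δ > 0 ∧ E(ℚ) meets the egg]`):
the first-order deformation of `ρ̄_{E,2}` along the Kummer class of the generator, which IS modular of level `4N` mod `2`.
Reading off `ψ` gives the UNIFORM LAW AN-40b: for odd Heegner `D`,
`I(y_D) ≡ ∑_{v ∣ D·∞} t(v) · a_{|D|/v}(E) (mod 2)` (Dirichlet convolution of the Kummer bit with `a_n`, `a_{|D|/∞} := a_{|D|}`),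
which contains -desc's egg law (`Δ > 0`: `I` odd iff egg bit `= 1` and every `p ∣ D` is a `3`-cycle prime), AN-39j / RM-10
(`Δ < 0`, `D = −ℓ`: `I` odd iff `t(ℓ) = 1`), RM-13, and new composite-`D` cases; and every instance `(E, all D)` is a FINITE
Sturm check at level `16N` (AN-40c).  Nearest print: Kriz–Li 2019 (arXiv:1606.03172) Thm. 1.12 (fixed `K`, twists by
`3`-cycle primes, `2` split in `K`, assumption ★) — the `Δ > 0`, `t ≡ 0` corner read in the twist variable; the `4`-cycle term,
the level-`4N` modularity of the parity sequence and the tangent-vector reading are not in print (searches in MEMO-an §26).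
-/

namespace Summit.BirchSwinnertonDyer.Rank1Residual.F1Sign2.ANg23

open Literature.NumberTheory.EllipticCurves Literature.NumberTheory.EllipticCurves.ModularForms UpperHalfPlane
open Summit.BirchSwinnertonDyer.Rank1Residual.F1Sign2
open Summit.BirchSwinnertonDyer.Rank1Residual.F1Sign2.TranspositionDoor
open scoped ModularForm
open CongruenceSubgroup
open scoped Classical
open Summit.BirchSwinnertonDyer.Rank1Residual.F1Sign2.WildPacket (LocallyPrimitiveAtTwo)

/-! ### §40.0 The Kummer line bits and the convolution count -/

/-- **Kummer line bit at an odd good prime `p`** (a property of `E(ℚ)`, no generator chosen): Frobenius at `p` is a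
TRANSPOSITION on `E[2]` (`(Δ/p) = −1`, so `E(ℚ_p)/2E(ℚ_p) ≅ ℤ/2`) AND `E(ℚ)` meets the non-norm coset at `p`
(some rational point reduces outside `2Ẽ(𝔽_p)`; for `E(ℚ) ≅ ℤ ⊕ (odd)` this says the generator is a local non-double,
equivalently `Frob_p` is a `4`-cycle in `Gal(ℚ(E[2], ½g)/ℚ) ↪ S₄`).
(Typer -ty g18: carrier VERBATIM, REF1 §202 (A2) read-back SOUND: `W` integral ⇒ `Δ.num = Δ`.) -/
def KummerBitAt (W : WeierstrassCurve ℚ) [W.IsIntegral ℤ] (p : ℕ) : Prop :=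
  ∃ hp : p.Prime, jacobiSym W.Δ.num p = -1 ∧ @MeetsNonNormAt W _ p ⟨hp⟩

/-- **Kummer line bit at `∞`**: `E(ℝ)/2E(ℝ) ≅ ℤ/2` (`Δ > 0`) and `E(ℚ)` meets the egg (-desc's `ε = +1`).
(Typer: carrier VERBATIM, REF1 §202 (A2) sound.) -/
def KummerBitAtInfinity (W : WeierstrassCurve ℚ) : Prop := 0 < W.Δ ∧ MeetsEgg W

/-- **The Kummer–Hecke convolution count** `#{v ∣ n·∞ : t(v) = 1 ∧ a_{n/v}(W) odd}` (`a_{n/∞} := a_n`; `W.LFunction m = a_m(W)`).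
(Typer: carrier VERBATIM, REF1 §202 (A2) sound — ℕ-division exact on the prime factors.) -/
noncomputable def kummerConvolutionCount (W : WeierstrassCurve ℚ) [W.IsIntegral ℤ] (n : ℕ) : ℕ :=
  (n.primeFactors.filter (fun p => KummerBitAt W p ∧ Odd (W.LFunction (n / p)))).card +
    (if KummerBitAtInfinity W ∧ Odd (W.LFunction n) then 1 else 0)

/-- The HEEGNER INDEX of a point `P ∈ E(K)`: `[E(K) : ℤP + E(K)_tors]` (`0` when infinite, e.g. `P` torsion in positive rank).
(Typer: carrier VERBATIM, REF1 §202 (A2) sound: `0` for torsion `P` in positive rank (Subgroup.index convention), consistent with every law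
below — `Odd 0` false, `Even 0` true.  R202c: at `d_K = −4, −3` (`u_K = 2, 3`) this is the index of the PLAIN trace `P_K`; Gross 1991 §1 states the
index formula for `D ≠ −3, −4` only, GZ V.(2.2) carries `u_K`.) -/
noncomputable def heegnerIndexOf {K : Type*} [Field K] [NumberField K] (W : WeierstrassCurve ℚ)
    (P : (W.baseChange K).toAffine.Point) : ℕ :=
  (AddSubgroup.zmultiples P ⊔ AddCommGroup.torsion (W.baseChange K).toAffine.Point).index

/-! ### §40.1 AN-40b — the uniform Kummer convolution law (CONJECTURE; census ENGINE TH × RM, MEMO-an §26) -/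

/-- **AN-40b `HeegnerIndexKummerConvolutionLawAtTwo` (CONJECTURE of this lens; the uniform `E`-level law).**
`W` of PRIME conductor `N`, analytic rank `1`, surjective mod-`2` image, odd torsion; `K` imaginary quadratic with ODD
discriminant `d_K` coprime to `N` satisfying the Heegner hypothesis (a `HeegnerDatum`); `Dt` a modular parametrisation with
ODD Manin constant; `P ∈ E(K)` mapping to the complex Heegner point.  THEN the Heegner index `I(P)` is odd **iff** the
Kummer–Hecke convolution count at `|d_K|` is odd:  `I(y_D) ≡ ∑_{v ∣ D∞} t(v)·a_{|D|/v} (mod 2)`.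
(`I(P) = 0`, even, when `y_D` is torsion — consistent: the law then predicts an even count, a checkable statement about
analytic rank `≥ 3` twists.)  Special cases: `Δ > 0` ⇒ `I` odd iff (egg bit `∧ a_{|D|}` odd) (-desc AN-10H's parity
shadow); `Δ < 0`, `D = −ℓ` ⇒ `I` odd iff `t(ℓ)` (AN-39j/RM-10, 256/256); `D = −ℓ₁ℓ₂ℓ₃`-type mixed terms are new.
Why it might fail: composite `D` with several transposition primes (predicted EVEN) is tested only up to `|D| ≤ 12 000`;
a Manin-constant or `Ш(E)[2]` subtlety off the prime-conductor table; the law is the `ψ`-readout of AN-40s and dies with it.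
[cite: GrossKohnenZagier1987, Thm. C] [cite: Kohnen1982, Thm. 2] [cite: KrizLi2019, Thm. 1.12, Rem. 1.14]
(Typer -ty g18, REF1-AUDIT §202: KILLED AS TYPED [refuted-misstated, J2 = BSD₂-extension] — prime conductor ⇏ `Ш(E)[2] = 0`: at the 24
optimal prime-conductor rank-one curves with `Ш_an = 4` (first 35083b1, 48731a1; Δ>0: 45979a1, 104239a1) `Ш(E/ℚ)[2] ↪ Ш(E/K)[2]` for every Heegner
`K`, so GZ ∘ BSD₂ (Gross 1991 Conj. 1.2) makes EVERY index even while the typed right-hand side is ODD at explicit `D` (35083b1: `−11, −19, −23, −43`;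
`REF1-data/b202/witness202.txt`).  FILED ONLY IN REF1's REPAIRED FORM C′ (R202a(i), MANDATORY): binder `ShaTwoTrivial W →` (tree
`DescentSignAtTwo`, the binder AN-22K `TranspositionDoorLawAtTwo` carries) inserted after `Odd W.torsionOrder →`; all J2 witnesses miss C′; with C′:
CONJECTURE, census 39 096/0 on odd `D`, the «only if» half forced by the one-place bookkeeping `res_K⁻¹ Sel₂(E/K) = S^T`, the «if» half = Kriz–Li-type
content in the Heegner-field variable.  REF2 v54 §7: nearest print Kriz–Li 2019 Thm. 1.12 (twist variable, odd `D`, ★); the `4`-cycle term not in print.) -/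
@[conjecture] def HeegnerIndexKummerConvolutionLawAtTwo : Prop :=
  ∀ (W : WeierstrassCurve ℚ) [W.IsElliptic] [W.IsGloballyMinimal] [W.IsIntegral ℤ] [NeZero (W.conductorNorm ℤ)],
    (W.conductorNorm ℤ).Prime → W.analyticRank = 1 → W.HasSurjectiveModNGaloisRep 2 → Odd W.torsionOrder →
    ShaTwoTrivial W →
    ∀ (K : Type) [Field K] [NumberField K], IsImaginaryQuadratic K → Odd (NumberField.discr K) →
      IsCoprime (NumberField.discr K) (W.conductorNorm ℤ : ℤ) →
      ∀ (Dt : ModularParametrizationData W (W.conductorNorm ℤ))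
        (H : HeegnerDatum (W.conductorNorm ℤ) (NumberField.discr K)) (ι : K →+* ℂ)
        (P : (W.baseChange K).toAffine.Point), Odd Dt.c →
        WeierstrassCurve.Affine.Point.map ι.toRatAlgHom P = heegnerPointComplex Dt H →
          (Odd (heegnerIndexOf W P) ↔ Odd (kummerConvolutionCount W (NumberField.discr K).natAbs))

/-- **AN-40b′ `HeegnerIndexParityRealLawAtTwo` (the `Δ > 0` closed form; CONJECTURE, corollary of AN-40b + AN-22J's parity
of transposition primes).**  Same hypotheses and `Δ_W > 0`: `I(P)` odd **iff** `E(ℚ)` meets the egg AND `a_{|d_K|}(W)` is odd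
(iff every prime of `d_K` is a `3`-cycle prime for `E[2]` — Kriz–Li's set `𝒮` read in the Heegner-field variable).
(Typer, REF1 §202: KILLED AS TYPED [refuted-misstated, J2] — 45979a1, 104239a1 and 11 more Δ>0 egg `Ш_an = 4` prime-conductor curves; FILED ONLY
IN REF1's REPAIRED FORM C′ (R202a(i)): `ShaTwoTrivial W →` after `Odd W.torsionOrder →`.  With C′: «only if» = bookkeeping + BSD₂; «if» = Kriz–Li 2019
Thm. 1.12's corner read in the twist variable (REF2 v53).) -/
@[conjecture] def HeegnerIndexParityRealLawAtTwo : Prop :=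
  ∀ (W : WeierstrassCurve ℚ) [W.IsElliptic] [W.IsGloballyMinimal] [W.IsIntegral ℤ] [NeZero (W.conductorNorm ℤ)],
    (W.conductorNorm ℤ).Prime → W.analyticRank = 1 → W.HasSurjectiveModNGaloisRep 2 → Odd W.torsionOrder → ShaTwoTrivial W → 0 < W.Δ →
    ∀ (K : Type) [Field K] [NumberField K], IsImaginaryQuadratic K → Odd (NumberField.discr K) →
      IsCoprime (NumberField.discr K) (W.conductorNorm ℤ : ℤ) →
      ∀ (Dt : ModularParametrizationData W (W.conductorNorm ℤ))
        (H : HeegnerDatum (W.conductorNorm ℤ) (NumberField.discr K)) (ι : K →+* ℂ)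
        (P : (W.baseChange K).toAffine.Point), Odd Dt.c →
        WeierstrassCurve.Affine.Point.map ι.toRatAlgHom P = heegnerPointComplex Dt H →
          (Odd (heegnerIndexOf W P) ↔ (MeetsEgg W ∧ Odd (W.LFunction (NumberField.discr K).natAbs)))

/-- **AN-40n `OddKummerConvolutionForcesHeegnerPointNonTorsion` (the NON-VANISHING COROLLARY; CONJECTURE — the rank-one
analogue of Ono–Skinner's non-vanishing of twisted central values).**  If the convolution count at `|d_K|` is odd then the
Heegner point is non-torsion (so `L'(E/K, 1) ≠ 0` and `E^{(d_K)}` has analytic rank `0` by Gross–Zagier; e.g. `Δ < 0`: every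
`D` with exactly one prime `ℓ₀` where `t = 1` and `3`-cycle primes elsewhere).  Formally implied by AN-40b (`Odd 0` is false).
(Typer, REF1 §202: SURVIVES as CONJECTURE at `Ш(E)[2] = 0`, VERBATIM per the port gate; EXPOSED at the 24 `Ш_an = 4` curves — there the bookkeeping gives
`Sel₂(E^{−ℓ}) = S_ℓ ≅ (ℤ/2)²` of `Ш(E)[2]`-lifts at a `t(ℓ) = 1` door, so a rank-2 twist (hence torsion `y_K` with count `1`) is ALLOWED and would refute the
row as typed; R202d(δ) (T-an): is any `L(E^{(−ℓ)},1) = 0` at the `t = 1` Heegner doors `ℓ < 3000` of 35083b1 / 48731a1?  The glue `nonTorsion_of_convolutionLaw`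
(AN-40b′-form ⇒ this conclusion under `ShaTwoTrivial W`) lives in the sibling kernel file.) -/
@[conjecture] def OddKummerConvolutionForcesHeegnerPointNonTorsion : Prop :=
  ∀ (W : WeierstrassCurve ℚ) [W.IsElliptic] [W.IsGloballyMinimal] [W.IsIntegral ℤ] [NeZero (W.conductorNorm ℤ)],
    (W.conductorNorm ℤ).Prime → W.analyticRank = 1 → W.HasSurjectiveModNGaloisRep 2 → Odd W.torsionOrder →
    ∀ (K : Type) [Field K] [NumberField K], IsImaginaryQuadratic K → Odd (NumberField.discr K) →
      IsCoprime (NumberField.discr K) (W.conductorNorm ℤ : ℤ) →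
      ∀ (Dt : ModularParametrizationData W (W.conductorNorm ℤ))
        (H : HeegnerDatum (W.conductorNorm ℤ) (NumberField.discr K)) (ι : K →+* ℂ)
        (P : (W.baseChange K).toAffine.Point), Odd Dt.c →
        WeierstrassCurve.Affine.Point.map ι.toRatAlgHom P = heegnerPointComplex Dt H →
          Odd (kummerConvolutionCount W (NumberField.discr K).natAbs) → ¬ IsOfFinAddOrder P

/-! ### §40.2 AN-40a — the θ-unit transport (THEOREM-CANDIDATE modulo GKZ Thm. C + Kohnen 1982 + the census constant `λ_E = 1`) -/

/-- The mod-2 weight-2 HECKE DEFECT operator `θ_ℓ = T_ℓ − a_ℓ` on integer sequences (exact only modulo `2`, where `ℓ ≡ 1`):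
`(θ_ℓ z)(n) = z(ℓn) + [ℓ ∣ n] z(n/ℓ) + a_ℓ z(n)`.
(Typer: carrier VERBATIM, REF1 §202 sound.) -/
def heckeDefect (a : ℕ → ℤ) (ℓ : ℕ) (z : ℕ → ℤ) : ℕ → ℤ :=
  fun n => z (ℓ * n) + (if ℓ ∣ n then z (n / ℓ) else 0) + a ℓ * z n

/-- **AN-40a `HeegnerThetaTransportAtTwo` (THEOREM-CANDIDATE modulo print + one census constant).**  For `W` as in AN-40b and a
parametrisation datum with odd Manin constant there is a weight-`2` cusp form `G` on `Γ₀(4N)` with INTEGER `q`-coefficients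
`z` (namely `G = g·θ`, `g` the primitive integral Kohnen form of `f_W`) such that
(i) `z(n)` is even for `n ≡ 1, 2 (mod 4)` (Kohnen plus space);
(ii) for every odd Heegner `d_K` coprime to `N`: `z(|d_K|) ≡ I(y_K) (mod 2)` (GKZ Thm. C, for the GKZ unit `λ_E` odd — `λ_E = 1` on the
two-engine census TH × RM, all at `Ш_an = 1`; REF1 §202 J2: EVEN modulo BSD₂ at the 24 `Ш_an = 4` prime-conductor curves, see the rider);
(iii) `(T_ℓ − a_ℓ)² G ≡ 0 (mod 2)` for every prime `ℓ ∤ 2N` (pure algebra: `A_ℓ² = T_{ℓ²}^{(3/2)}` on `𝔽₂[[q]]`, `a_ℓ² ≡ a_ℓ`).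
Consequence: `ℓ ↦ I(y_{−ℓ}) mod 2` is FROBENIAN (Chebotarev in the `𝔽₂`-Hecke field of level `4N`), and every law about these
parities is a statement about one element of `S₂(Γ₀(4N); 𝔽₂)`.  Why it might fail: only through (ii)'s constant (`λ_E` even
for some optimal prime-conductor curve) — (i), (iii) are theorems given Kohnen 1982.
[cite: GrossKohnenZagier1987, Thm. C] [cite: Kohnen1982, Thm. 1, Thm. 2] [cite: James1999, p. 3] [cite: OnoSkinner1998, Thm. 1]
(Typer -ty g18, REF1 §202: SURVIVES AS TYPED, filed VERBATIM as the ∃-statement — THEOREM-CANDIDATE modulo GKZ Thm. C + Kohnen 1982 + the constant; (i)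
plus space and (iii) `(T_ℓ − a_ℓ)² G ≡ 0 (2)` are print (Kohnen 1982 Thm. 1/2).  DOCSTRING CORRECTED per R202a(iii): the INTENDED witness `G = g̃θ` with
«`λ_E = 1`» is FALSE modulo BSD₂ at the 24 optimal prime-conductor rank-one curves with `Ш_an = 4` (REF1 §202 J2: every `I(y_D)` even there, so the GKZ
unit `λ_E` is even and `G = 0, z = 0` witnesses (i)–(iv)); the honest theorem-candidate is (ii) with `z(|d_K|)·λ_E ≡ I` for the GKZ unit, or (ii) under
`ShaTwoTrivial W`.  -an's «Why it might fail: only through (ii)'s constant» is thus realised exactly off `ShaTwoTrivial`.  A40-T1 (-an → -ty): Kohnen 1982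
Thm. 1(ii) and GKZ Thm. C as Literature facts would make (iii) a one-page theorem — not filed here (acq-06812).  REF2 v54 §7: θ-transport of VALUES is
print (James 1999 p. 3, Ono–Skinner 1998); of rank-one Heegner INDICES: not in print.) -/
def HeegnerThetaTransportAtTwo : Prop :=
  ∀ (W : WeierstrassCurve ℚ) [W.IsElliptic] [W.IsGloballyMinimal] [W.IsIntegral ℤ] [NeZero (W.conductorNorm ℤ)],
    (W.conductorNorm ℤ).Prime → W.analyticRank = 1 → W.HasSurjectiveModNGaloisRep 2 → Odd W.torsionOrder →
    ∀ (Dt : ModularParametrizationData W (W.conductorNorm ℤ)), Odd Dt.c →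
      ∃ (G : CuspForm (Gamma0 (4 * W.conductorNorm ℤ)) 2) (z : ℕ → ℤ),
        (∀ n : ℕ, cuspCoeff G n = (z n : ℂ)) ∧
        (∀ n : ℕ, n % 4 = 1 ∨ n % 4 = 2 → Even (z n)) ∧
        (∀ ℓ : ℕ, ℓ.Prime → ℓ ≠ 2 → ℓ ≠ W.conductorNorm ℤ →
          ∀ n : ℕ, Even (heckeDefect (fun m => W.LFunction m) ℓ (heckeDefect (fun m => W.LFunction m) ℓ z) n)) ∧
        (∀ (K : Type) [Field K] [NumberField K], IsImaginaryQuadratic K → Odd (NumberField.discr K) →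
          IsCoprime (NumberField.discr K) (W.conductorNorm ℤ : ℤ) →
          ∀ (H : HeegnerDatum (W.conductorNorm ℤ) (NumberField.discr K)) (ι : K →+* ℂ) (P : (W.baseChange K).toAffine.Point),
            WeierstrassCurve.Affine.Point.map ι.toRatAlgHom P = heegnerPointComplex Dt H →
              (Odd (z (NumberField.discr K).natAbs) ↔ Odd (heegnerIndexOf W P)))

/-! ### §40.3 AN-40s — the structure conjecture (socle / Loewy shape of the Hecke module `𝕋̄·Ĝ`) -/

/-- **AN-40s `HeegnerParityHeckeModuleLawAtTwo` (STRUCTURE CONJECTURE; the tangent-vector reading).**  With `G, z` as in AN-40a,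
`h(ℓ) = [ℓ ≡ 3 (mod 4)]`, `t(ℓ)` the Kummer line bit: for all primes `ℓ₁, ℓ₂ ∤ 2N` and all `n`,
`(T_{ℓ₁} − a_{ℓ₁})(T_{ℓ₂} − a_{ℓ₂}) G ≡ (h(ℓ₁) a_{ℓ₁} t(ℓ₂) + h(ℓ₂) a_{ℓ₂} t(ℓ₁)) · f_W (mod 2)`
— the Hecke module generated by `Ĝ` has SOCLE `f̄_W`, Loewy length `≤ 3`, and is the quotient `A/Ann ψ` of
`A = 𝔽₂[ν₁,ν₂]/(ν₁²,ν₂²)` along `T_ℓ ↦ (1 + h(ℓ)ν₁)(a_ℓ + t(ℓ)ν₂)`: the product of the infinitesimal `χ₋₄`-twist and the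
first-order deformation of `ρ̄_{W,2}` along the Kummer class of `E(ℚ)` (which is thereby MODULAR of level `4N` mod `2`).
AN-40b is its `ψ`-readout on squarefree `n`.  Why it might fail: a third nilpotent direction (e.g. from `Ш(E)[2]`-type classes or
the level-raising congruences at `2`) would enlarge the module; stated on the prime-conductor big-image table only.
[cite: GrossKohnenZagier1987, Thm. C] [cite: Kohnen1982, Thm. 2]
(Typer, REF1 §202: SURVIVES-FLAGGED — at a `Ш(E)[2] ≠ 0` curve the Heegner clause forces `z(|d_K|)` even on the whole odd Heegner progression (mod BSD₂)
while the defect clause forbids `z ≡ 0`, so AS TYPED it carries the wrong witness at the 24 curves; FILED ONLY IN REF1's REPAIRED FORM C′ (R202a(i)):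
`ShaTwoTrivial W →` after `Odd W.torsionOrder →`; with C′ it is the clean structure conjecture (census §G 49 936/0 + 34 951/0).  REF2 v54 §7: the
tangent-vector / `A = 𝔽₂[ν₁,ν₂]/(ν₁²,ν₂²)` reading is NOT in print.) -/
@[conjecture] def HeegnerParityHeckeModuleLawAtTwo : Prop :=
  ∀ (W : WeierstrassCurve ℚ) [W.IsElliptic] [W.IsGloballyMinimal] [W.IsIntegral ℤ] [NeZero (W.conductorNorm ℤ)],
    (W.conductorNorm ℤ).Prime → W.analyticRank = 1 → W.HasSurjectiveModNGaloisRep 2 → Odd W.torsionOrder →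
    ShaTwoTrivial W →
    ∀ (Dt : ModularParametrizationData W (W.conductorNorm ℤ)), Odd Dt.c →
      ∃ (G : CuspForm (Gamma0 (4 * W.conductorNorm ℤ)) 2) (z : ℕ → ℤ),
        (∀ n : ℕ, cuspCoeff G n = (z n : ℂ)) ∧
        (∀ (K : Type) [Field K] [NumberField K], IsImaginaryQuadratic K → Odd (NumberField.discr K) →
          IsCoprime (NumberField.discr K) (W.conductorNorm ℤ : ℤ) →
          ∀ (H : HeegnerDatum (W.conductorNorm ℤ) (NumberField.discr K)) (ι : K →+* ℂ) (P : (W.baseChange K).toAffine.Point),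
            WeierstrassCurve.Affine.Point.map ι.toRatAlgHom P = heegnerPointComplex Dt H →
              (Odd (z (NumberField.discr K).natAbs) ↔ Odd (heegnerIndexOf W P))) ∧
        (∀ ℓ₁ ℓ₂ : ℕ, ℓ₁.Prime → ℓ₂.Prime → ℓ₁ ≠ 2 → ℓ₂ ≠ 2 → ℓ₁ ≠ W.conductorNorm ℤ → ℓ₂ ≠ W.conductorNorm ℤ →
          ∀ n : ℕ, 0 < n →
            (Odd (heckeDefect (fun m => W.LFunction m) ℓ₁ (heckeDefect (fun m => W.LFunction m) ℓ₂ z) n) ↔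
              Odd (((if ℓ₁ % 4 = 3 ∧ Odd (W.LFunction ℓ₁) ∧ KummerBitAt W ℓ₂ then 1 else 0) +
                    (if ℓ₂ % 4 = 3 ∧ Odd (W.LFunction ℓ₂) ∧ KummerBitAt W ℓ₁ then 1 else 0)) * W.LFunction n)))

/-! ### §40.4 AN-40c — the per-curve Sturm certificate (DECIDABILITY of every instance, modulo AN-40a) -/

/-- **Sturm's bound for `Γ₀(M)` in weight `2`**: `⌊(2/12)·[SL₂(ℤ) : Γ₀(M)]⌋ = ⌊M ∏_{p ∣ M}(1 + 1/p) / 6⌋`. [cite: Sturm1987, Thm. 1]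
(Typer: carrier VERBATIM; `sturmBoundGamma0Wt2 (16N) = 4(N+1)` for prime `N` (REF1 §202 (A2)).) -/
noncomputable def sturmBoundGamma0Wt2 (M : ℕ) : ℕ :=
  (M * ∏ p ∈ M.primeFactors, (p + 1)) / (6 * ∏ p ∈ M.primeFactors, p)

/-- **AN-40c `HeegnerParitySturmCertificateAtTwo` (THEOREM-CANDIDATE modulo AN-40a and Sturm 1987 Thm. 1 at a prime dividing
the level — the tree's `Sturm1987_congruence_modPrime_gamma1` assumes `p ∤ N` and does not cover `p = 2 ∣ 16N`).**  For `W`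
as above with `Δ_W > 0`: IF the parity law `z(n) ≡ [egg bit]·[n ≡ 3 (4)]·a_n(W) (mod 2)` holds for all `n ≤` Sturm's bound
of `Γ₀(16N)` (`= 4(N+1)` for prime `N`; `152` for `37a1`), THEN it holds for ALL `n` — because `Ĝ − Ĝ|U₂V₂` and
`∑_{n ≡ 3 (4)} a_n qⁿ = ½(f_odd − f_odd ⊗ χ₋₄)` both lie in `S₂(Γ₀(16N)) ∩ ℤ[[q]]`.  Hence every instance
`(E; all odd D)` of AN-40b′ is a finite computation (BC5 rungs per curve).  Why it might fail: only via AN-40a (ii). [cite: Sturm1987, Thm. 1]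
(Typer, REF1 §202: SURVIVES, THEOREM-SHAPE = PRINT-ASSEMBLY, filed VERBATIM as a plain `def`: `∑_{n≡3(4)} (z(n) − ε a_n) qⁿ = (G_odd − G_odd⊗χ₋₄)/2 −
ε(f_odd − f_odd⊗χ₋₄)/2 ∈ S₂(Γ₀(16N), ℤ)` (twist level `lcm(4N,16) = 16N`, Shimura Prop. 3.64) and Sturm 1987 Thm. 1 at ANY prime including `p = 2 ∣ 16N`.
R202f (mutation, information only, NOT applied): the plus-space hypothesis and every curve hypothesis except modularity are UNUSED — the statement holds
for every `W` and every `G ∈ S₂(Γ₀(4N), ℤ)`.) -/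
def HeegnerParitySturmCertificateAtTwo : Prop :=
  ∀ (W : WeierstrassCurve ℚ) [W.IsElliptic] [W.IsGloballyMinimal] [W.IsIntegral ℤ] [NeZero (W.conductorNorm ℤ)],
    (W.conductorNorm ℤ).Prime → W.analyticRank = 1 → W.HasSurjectiveModNGaloisRep 2 → Odd W.torsionOrder → 0 < W.Δ →
    ∀ (G : CuspForm (Gamma0 (4 * W.conductorNorm ℤ)) 2) (z : ℕ → ℤ) (ε : ℤ), (∀ n : ℕ, cuspCoeff G n = (z n : ℂ)) →
      (∀ n : ℕ, n % 4 = 1 ∨ n % 4 = 2 → Even (z n)) →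
      (∀ n : ℕ, n % 4 = 3 → n ≤ sturmBoundGamma0Wt2 (16 * W.conductorNorm ℤ) → Even (z n - ε * W.LFunction n)) →
      ∀ n : ℕ, n % 4 = 3 → Even (z n - ε * W.LFunction n)

/-! ## AN-40e — the law on ALL fundamental Heegner discriminants (even `D` included), and the identity-component evenness -/

/-- `τ₂(E)`: `E(ℚ₂)[2] ≠ 0`, i.e. the `2`-division cubic `4x³ + b₂x² + 2b₄x + b₆` has a root in `ℚ₂`
(ENGINE TH column `r2loc ≥ 1`; on the 13 rank-one curves of the g23 table it coincides with `a₂(E)` odd).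
(Typer: carrier VERBATIM, REF1 §202 sound: `= [E(ℚ₂)[2] ≠ 0]`.) -/
def HasTwoAdicTwoTorsion (W : WeierstrassCurve ℚ) : Prop :=
  ∃ x : ℚ_[2], (W.twoTorsionPolynomial.toPoly.map (algebraMap ℚ ℚ_[2])).IsRoot x

/-- Finite Kummer convolution `s_E(u) := #{p ∣ u : t_E(p) = 1 ∧ a_{u/p}(E) odd}` (no archimedean term).
(Typer: carrier VERBATIM; K202.1 `kummerConvolutionFinite W 1 = 0` in the kernel file.) -/
noncomputable def kummerConvolutionFinite (W : WeierstrassCurve ℚ) [W.IsIntegral ℤ] (u : ℕ) : ℕ :=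
  (u.primeFactors.filter fun p => KummerBitAt W p ∧ Odd (W.LFunction (u / p))).card

/-- **The right-hand side of AN-40e** at a fundamental discriminant `D < 0` (`|D| = u`, `4u` or `8u`, `u` odd squarefree):
* `Δ_E > 0`:  `MeetsEgg E` and — `D` odd: `a_{|D|}` odd; `|D| = 4u`: `¬τ₂(E)` and `a_u` odd; `8 ∣ D`: never;
* `Δ_E < 0`:  `D` odd: `s_E(|D|)` odd; `|D| = 4u`: `a_u + [¬τ₂(E)]·s_E(u)` odd; `|D| = 8u`: `a_u` odd AND (`τ₂(E)` or `β(E)` = the tree's `LocallyPrimitiveAtTwo E`: some rational point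
  is not `2`-divisible in `E(ℚ₂)`) — REF1 R202a(ii), filed only in this repaired form.
(`a_n = W.LFunction n`; `s_E` = `kummerConvolutionFinite`.)
(Typer -ty g18: FILED ONLY IN REF1's REPAIRED FORM (R202a(ii), MANDATORY; REF2 v54 §7.3 (‡) / PREDICTION #9, co-signed by REF1 §202 with a second
engine and kernel K202.2): AS SKETCHED the `Δ<0, 8 ∣ D` branch read `Odd (a_{|D|/8})` alone, asserting `I(y_{ℚ(√−2)})` ODD on EVERY `Δ<0`, `N ≡ 1,3 (8)`
curve; but at `¬τ₂` with the generator `g ∈ 2E(ℚ₂)` Kramer 1981 Prop. 4 (`i₂ = 1`) + `res_K⁻¹ Sel₂(E/K) = S^{2}`, `dim S^{2} = dim S_{2} + 1` give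
`Ш(E/K_{−8u})[2] ≠ 0` UNCONDITIONALLY, hence EVEN modulo GZ ∘ BSD₂(E/K) — first witnesses 1051a1, 1259a1, 1987a1 at `D = −8` (`Ш_an = 1`, so
`ShaTwoTrivial` does not rescue; census `REF1-data/b202/scan202.txt`: 0/6 such curves with `N < 700` — why -an's §F saw `−8u` 2 963/0 — 3/9 for
`700 ≤ N < 2000`, 350/784 below `5·10⁵`; decisive datum `c̃(8)` there in -an's j331386, REF1+REF2 predict EVEN).  REPAIR as typed here: the branch is
`Odd (a_{|D|/8}) ∧ (τ₂(W) ∨ β(W))` with `β` = the tree's `LocallyPrimitiveAtTwo W` (`WildPacketAtTwo`, AN-32's bottom bit: some rational point is NOT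
`2`-divisible in `E(ℚ₂)`) rendering REF1's `¬ LocTwoDivisibleAtTwo W` by the EXISTING tree carrier (typer rule: cite, do not re-declare); the `τ₂`
sub-branch is left as sketched pending R202d(γ) (Kramer Prop. 5 bit; 11 ordinary `Δ<0` curves `N < 700`, 0 violations).  The `−4u` and `Δ>0` clauses
are bookkeeping-consistent (K202.3–5).) -/
noncomputable def heegnerParityRHS (W : WeierstrassCurve ℚ) [W.IsIntegral ℤ] (D : ℤ) : Prop :=
  let n := D.natAbs
  if 0 < W.Δ then
    MeetsEgg W ∧
      (if n % 2 = 1 then Odd (W.LFunction n)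
       else if n % 8 = 4 then ¬ HasTwoAdicTwoTorsion W ∧ Odd (W.LFunction (n / 4))
       else False)
  else
    (if n % 2 = 1 then Odd (kummerConvolutionFinite W n)
     else if n % 8 = 4 then
       Odd ((W.LFunction (n / 4)) +
            (if HasTwoAdicTwoTorsion W then 0 else (kummerConvolutionFinite W (n / 4) : ℤ)))
     else (Odd (W.LFunction (n / 8)) ∧ (HasTwoAdicTwoTorsion W ∨ LocallyPrimitiveAtTwo W)))

/-- **AN-40e `HeegnerIndexParityLawAllFundamentalAtTwo` (CONJECTURE of this lens; supersedes AN-40b/b′ by covering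
`D ≡ 0 (mod 4)`).**  `E/ℚ` optimal of odd prime conductor `N`, analytic rank one, `ρ̄_{E,2}` surjective, odd torsion;
`K` imaginary quadratic of discriminant `D` prime to `N` satisfying the Heegner hypothesis, `y_K` the Heegner point of a
parametrisation with odd Manin constant.  Then `[E(K) : ℤ y_K + E(K)_tors]` is odd iff `heegnerParityRHS E D`.
Census (ENGINE TH kit j331452 + j331293, `census_CP4.md` §F): 12 first-order curves (`37a1 … 229a1`), every fundamental
Heegner `|D| ≤ 12 000`: Δ<0 — odd `D` 12 075/0, `−4u` 3 023/0, `−8u` 2 963/0; Δ>0 — 9 028+/0, 2 072+/0, 2 293+/0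
disagreements `0`; the `Δ>0`, `¬MeetsEgg` curve `359a1`: all indices even (two-engine `2|c̃(ℓ)| = n(ℓ)` 5/5, genus sums 15/15).
Why it might fail: an identity-Frobenius prime `p ∣ D` with `E(ℚ_p)`-halving obstruction interacting with `Ш(E/K)[2]`
beyond `|D| ≤ 12 000`; the `τ₂` clause rests on 13 curves (`τ₂ = [a₂ odd]` on all of them — the two may differ in general).
[cite: GrossKohnenZagier1987, Thm. C] [cite: KrizLi2019, Thm. 1.12] (the `Δ>0`, odd-`D`, all-`3`-cycle corner)
(Typer -ty g18, REF1-AUDIT §202: KILLED AS TYPED, twice [refuted-misstated] — (J2) as AN-40b on odd `D`; (‡) the `Δ<0, 8 ∣ D` clause, first witnesses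
1051a1 / 1259a1 / 1987a1 at `D = −8`.  FILED ONLY IN REF1's REPAIRED FORM C′₁ ∧ C′₂ ∧ R202c: C′₁ = `ShaTwoTrivial W →` after `Odd W.torsionOrder →`
(R202a(i)); C′₂ = the `8 ∣ D` branch of `heegnerParityRHS` conjoined with `τ₂ ∨ β` (R202a(ii), see that carrier); R202c = the zero-cost side-condition
binder `4 < |d_K|` (`u_K = 1`: at `d_K = −4` kernel K202.3/K202.5 show the sketched law asserts `I(y_{ℚ(i)})` odd on every `Δ<0`, `N ≡ 1 (4)` curve, a
`u_K = 2` instance Gross 1991 excludes; -an may drop the binder by stating the `u_K` convention — T-an: Sage `heegner_index(−4)` at 677a1, `c̃(4) = 1`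
there).  With C′₁ ∧ C′₂ ∧ R202c: CONJECTURE, census 39 096/0 + 13 393+/0, every clause bookkeeping-consistent.  The kernel glue to AN-40z is re-threaded
accordingly in the sibling kernel file.) -/
@[conjecture] def HeegnerIndexParityLawAllFundamentalAtTwo : Prop :=
  ∀ (W : WeierstrassCurve ℚ) [W.IsElliptic] [W.IsGloballyMinimal] [W.IsIntegral ℤ] [NeZero (W.conductorNorm ℤ)],
    (W.conductorNorm ℤ).Prime → W.conductorNorm ℤ ≠ 2 → W.analyticRank = 1 → W.HasSurjectiveModNGaloisRep 2 →
    Odd W.torsionOrder → ShaTwoTrivial W →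
    ∀ (K : Type) [Field K] [NumberField K], IsImaginaryQuadratic K → 4 < (NumberField.discr K).natAbs →
      IsCoprime (NumberField.discr K) (W.conductorNorm ℤ : ℤ) →
      ∀ (Dt : ModularParametrizationData W (W.conductorNorm ℤ))
        (H : HeegnerDatum (W.conductorNorm ℤ) (NumberField.discr K)) (ι : K →+* ℂ)
        (P : (W.baseChange K).toAffine.Point), Odd Dt.c →
        WeierstrassCurve.Affine.Point.map ι.toRatAlgHom P = heegnerPointComplex Dt H →
          (Odd (heegnerIndexOf W P) ↔ heegnerParityRHS W (NumberField.discr K))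

/-- **AN-40z `HeegnerIndexEvenOnIdentityComponentAtTwo` (CONJECTURE; the qualitative shadow of AN-40e at `Δ > 0`,
`E(ℚ) ⊂ E⁰(ℝ)`).**  Same `E`, with `Δ_E > 0` and NO rational point on the egg: EVERY Heegner index
`[E(K) : ℤ y_K + tors]` is even — equivalently (rank `E(K) = 1`) `y_K ∈ 2E(K) + E(K)_tors`.
Mechanism: `loc_∞ δ(g) = 0`, so the Selmer class of the generator survives every quadratic twist at the real place and
`Sel₂(E^{(D)}) ≠ 0` is forced unless a `4`-cycle prime divides `D` — impossible an even number of times at `Δ > 0`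
(AN-22J); with GZ + BSD₂ over `K` this is `2 ∣ I(y_K)`.  Census: `359a1` — Sage `heegner_index` `n(7), n(19), n(31) =
2, 2, 4 = 2|c̃|` and g22 T-RM10 (`a_ℓ` odd ⇒ `n(ℓ)` odd iff egg) 149/149 + 52/52.  The HALF-index parity `c̃(|D|) mod 2`
is NOT determined by Frobenius in `ℚ(E[4], ½g)` (3-cycle classes carry only `(a_ℓ mod 4, ℓ mod 4)`; data 117 odd /130 even),
conjecturally a Cassels–Tate / `4`-Selmer quantity of the twist.
[cite: GrossZagier1986, I.(6.3) and V.(2.2)] [cite: GrossKohnenZagier1987, Thm. C]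
(Typer, REF1 §202: SURVIVES, filed VERBATIM (`@[conjecture]` per the port gate) — STRONGER THAN ITS DOCSTRING MECHANISM but RIGHT by bookkeeping: at `Δ>0`,
`∞ ∈ T` for every `D < 0` and `dim S^T = dim S_T + |T|`, so at `¬MeetsEgg` `κ_g ∈ S_{∞}` ⇒ `dim Sel₂(E/K) ≥ 2` for EVERY Heegner `K` ⇒ `Ш(E/K)[2] ≠ 0`
unconditionally ⇒ EVEN modulo GZ ∘ BSD₂(E/K): THEOREM-CANDIDATE modulo BSD₂(E/K) (or a Kolyvagin-at-2 upper bound, not in print at `p = 2`: Gross 1991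
Thm. 1.3 has `t_{E/K}` a power of `2`); J2 only helps, (‡) n/a at `Δ>0`, `d_K = −4` only adds 2-divisibility.  REF2 A40-R1: «`E(ℚ) ⊂ E⁰(ℝ)` ⇒ `y_K ∈
2E(K) + tors`» not found in print as such.) -/
@[conjecture] def HeegnerIndexEvenOnIdentityComponentAtTwo : Prop :=
  ∀ (W : WeierstrassCurve ℚ) [W.IsElliptic] [W.IsGloballyMinimal] [W.IsIntegral ℤ] [NeZero (W.conductorNorm ℤ)],
    (W.conductorNorm ℤ).Prime → W.conductorNorm ℤ ≠ 2 → W.analyticRank = 1 → W.HasSurjectiveModNGaloisRep 2 →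
    Odd W.torsionOrder → 0 < W.Δ → ¬ MeetsEgg W →
    ∀ (K : Type) [Field K] [NumberField K], IsImaginaryQuadratic K →
      IsCoprime (NumberField.discr K) (W.conductorNorm ℤ : ℤ) →
      ∀ (Dt : ModularParametrizationData W (W.conductorNorm ℤ))
        (H : HeegnerDatum (W.conductorNorm ℤ) (NumberField.discr K)) (ι : K →+* ℂ)
        (P : (W.baseChange K).toAffine.Point), Odd Dt.c →
        WeierstrassCurve.Affine.Point.map ι.toRatAlgHom P = heegnerPointComplex Dt H →
          Even (heegnerIndexOf W P)

/-- **AN-40h — filed as `SingleHeckeDefectFormExistsAtTwo`, the TYPED content of -an's `HeegnerParitySingleHeckeDefectLawAtTwo` (CONJECTURE; the first-order Hecke structure of `Ĝ = g̃θ mod 2`,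
single-defect form, both signs).**  With `z(n) = c̃(n) mod 2` the parity sequence of the primitive Kohnen form and
`a = (a_n(E))`: for every odd prime `ℓ ≠ N` and every odd `n` prime to `N`,
`(T_ℓ − a_ℓ)z (n) ≡ [Δ>0]·η·h(ℓ)a_ℓ a_n + [Δ<0]·( h(ℓ) a_ℓ s(n) + t(ℓ) a_n (h(n) + h(ℓ)) )  (mod 2)`,
`h(m) = [m ≡ 3 (4)]`, `η = MeetsEgg`, `t = KummerBitAt`, `s(n)` the `ν₂`-coefficient of `∏_{p^k ∥ n} T_{p^k}` under
`T_p ↦ a_p + t(p)ν₂` (= `kummerConvolutionFinite` on squarefree `n`).  I.e. the `𝔽₂`-Hecke module of `Ĝ` is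
`𝔽₂[ν₁]/ν₁²` (Δ>0, η = 1), `0`-socle-only … , resp. `A/Ann ψ`, `A = 𝔽₂[ν₁,ν₂]/(ν₁²,ν₂²)`, `T_ℓ ↦ (1+h(ℓ)ν₁)(a_ℓ+t(ℓ)ν₂)`,
`ψ = [ν₁ν₂]^*` (Δ<0).  Census §G: Δ<0 49 936/0, Δ>0 34 951/0 (`gcd(n,N) = 1`, `ℓ ≤ 13`, `ℓn ≤ 12 000`); at `N ∣ n`
the fit `T_N ↦ (1+h(N)ν₁)(1+t_Nν₂)` succeeds on 7/7 curves with `t_N = τ₂(E)` (6 determined).  Stated here for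
squarefree `n` only (where `s = kummerConvolutionFinite`). [cite: GrossKohnenZagier1987, Thm. C] [cite: Kohnen1982, Thm. 1]
(Typer -ty g18, REF1 §202 (A2) + R202b: -an's AN-40h `HeegnerParitySingleHeckeDefectLawAtTwo` SURVIVES but is MIS-TYPED — the Heegner readout «`z(|D|) ≡
I(y_D)` on odd Heegner `D`» was only a `--` comment inside the body; the TYPE is a pure mod-2 level-`4N` existence statement for a defect-prescribed sequence
with NO occurrence of `heegnerIndexOf` / `heegnerPointComplex` (non-vacuous: `z = 0` fails).  Per R202b's second option it is filed under the name of
WHAT IT TYPES (body verbatim, the misleading comment line dropped); the Heegner-reading structure statement is AN-40s `HeegnerParityHeckeModuleLawAtTwo`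
above (which carries the readout clause and inherits R202a); a re-typed AN-40h with the readout is -an's to sketch (R202b first option).  Conjecture-grade:
the census §G concerns `g̃θ`, which this type does not name.) -/
@[conjecture] def SingleHeckeDefectFormExistsAtTwo : Prop :=
  ∀ (W : WeierstrassCurve ℚ) [W.IsElliptic] [W.IsGloballyMinimal] [W.IsIntegral ℤ] [NeZero (W.conductorNorm ℤ)],
    (W.conductorNorm ℤ).Prime → W.conductorNorm ℤ ≠ 2 → W.analyticRank = 1 → W.HasSurjectiveModNGaloisRep 2 →
    Odd W.torsionOrder → (W.Δ < 0 ∨ MeetsEgg W) →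
    ∃ (G : CuspForm (CongruenceSubgroup.Gamma0 (4 * W.conductorNorm ℤ)) 2) (z : ℕ → ℤ),
      (∀ n, cuspCoeff G n = (z n : ℂ)) ∧
      ∀ ℓ : ℕ, ℓ.Prime → ℓ ≠ 2 → ℓ ≠ W.conductorNorm ℤ →
        ∀ n : ℕ, Odd n → Squarefree n → Nat.Coprime n (W.conductorNorm ℤ) →
          let h : ℕ → ℤ := fun m => if m % 4 = 3 then 1 else 0
          let t : ℕ → ℤ := fun p => if KummerBitAt W p then 1 else 0
          let egg : ℤ := if MeetsEgg W then 1 else 0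
          let rhs : ℤ :=
            if 0 < W.Δ then egg * h ℓ * W.LFunction ℓ * W.LFunction n
            else h ℓ * W.LFunction ℓ * (kummerConvolutionFinite W n : ℤ) + t ℓ * W.LFunction n * (h n + h ℓ)
          Even (heckeDefect (fun m => W.LFunction m) ℓ z n - rhs)

end Summit.BirchSwinnertonDyer.Rank1Residual.F1Sign2.ANg23
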